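import Literature.MathematicalPhysics.QuantumLattice.SpinChainsAkltSmallRingsProofs
import Literature.MathematicalPhysics.QuantumLattice.SpinChainsKnabeProofs
import Literature.MathematicalPhysics.QuantumLattice.SpinChainsAkltUniqueProofs
import HarnessLib

/-!
# Discharged fact: the uniform spectral gap of the AKLT ring, `aklt_gap` (Knabe's method)

Trunk **T-QLATTICE**. Sibling proof file of
`Literature/MathematicalPhysics/QuantumLattice/SpinChains.lean` (theorem-only), assembling
`aklt_gap`: for every `L ≥ 3` the AKLT ring `H_L = Σ_{i ∈ ℤ/L} (𝐒_i·𝐒_{i+1} + ⅓(𝐒_i·𝐒_{i+1})²)`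
satisfies `(H_L - E₀)² ≥ ¼ (H_L - E₀)`, `E₀ = -2L/3`, whence — given uniqueness of the ground state
(`aklt_unique_periodic`) — the uniform spectral gap `E₁(L) - E₀(L) ≥ 1/4`
(`aklt_gap_of_aklt_unique_periodic`). Steps:

1. `akltRing_block_sq_sub_smul_posSemidef`: the four-site local gap `h_x² - (5/12) h_x ≥ 0` on every
   block `{x, …, x+3}` of the ring (`4 ≤ L`), transported from the abstract block
   (`akltOpenFour_sq_sub_smul_posSemidef`) by the positive unital homomorphism `localOp ∘ onRingBlock`;
2. `akltProj_ring_commute`: bond projections at non-adjacent bonds commute;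
3. `akltRing_sumProj_sq_sub_smul_posSemidef`: `(ΣP₂)² - ⅛ ΣP₂ ≥ 0` for all `L ≥ 3` — Knabe's
   criterion `knabe_ring_sq_sub_smul_posSemidef` for `L ≥ 5` (`(3·5/12 - 1)/2 = 1/8`), the exact
   ring certificates for `L = 3, 4`;
4. `aklt_gap_of_aklt_unique_periodic`: `H_L - E₀ = 2 ΣP₂` (`akltRing_eq`, `akltRing_groundEnergy`)
   and `hasSpectralGap_of_sq_sub_smul_posSemidef`;
5. `aklt_gap_holds`: with `aklt_unique_periodic_holds` (`SpinChainsAkltUniqueProofs`).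

The constant `γ = 1/4` is far from optimal (the AKLT gap is `≈ 0.350` for `H_L`, i.e. `≈ 0.700` in
the normalisation `2ΣP₂`); only positivity uniformly in `L` is asserted by `aklt_gap`.

## Sources

I. Affleck, T. Kennedy, E. H. Lieb, H. Tasaki, *Valence bond ground states in isotropic quantum
antiferromagnets*, Comm. Math. Phys. **115** (1988) 477–528, §2 (existence of the gap of the
periodic chain); S. Knabe, J. Stat. Phys. **52** (1988) 627–638, §2 (the finite-size criterion) and
§3 (its verification for the AKLT chain); H. Tasaki, *Physics and Mathematics of Quantum Many-Body
Systems* (2020), Thm. 7.5 (the locator carried by the fact `aklt_gap`); M. Fannes, B. Nachtergaele,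
R. F. Werner, CMP **144** (1992) Thm. 6.4.
-/

noncomputable section

namespace Literature.MathematicalPhysics.QuantumLattice

/-! ### Assembly: the uniform gap of the AKLT ring -/

section Assembly

open Matrix Complex Finset
open scoped ComplexOrder

/-- Transport of block operators is compatible with subtraction. [folklore] -/
theorem localOp_submatrix_sub {Λ : Type*} [Fintype Λ] [DecidableEq Λ] {q : ℕ} {ι : Type*}
    (X : Finset Λ) (g : ι → X) (P Q : Op ι q) :
    localOp X ((P - Q).submatrix (fun σ j => σ (g j)) (fun σ j => σ (g j))) =
      localOp X (P.submatrix (fun σ j => σ (g j)) (fun σ j => σ (g j))) -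
        localOp X (Q.submatrix (fun σ j => σ (g j)) (fun σ j => σ (g j))) := by
  rw [sub_eq_add_neg, ← neg_one_smul ℂ Q, localOp_submatrix_add, localOp_submatrix_smul, neg_one_smul,
    ← sub_eq_add_neg]

/-- **Placing a bond projection of the abstract four-site block on the ring**: along the block
`{x, x+1, x+2, x+3} ⊆ ℤ/L` (`4 ≤ L`), `P₂(a, b) ↦ P₂(x+a, x+b)`. [folklore] -/
theorem localOp_submatrix_ringBlock_akltProj (L : ℕ) [NeZero L] (hL : 4 ≤ L) (x : ZMod L)
    (a b : Fin 4) :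
    localOp (ringBlock L 4 x) ((akltProj a b).submatrix (fun σ i => σ (ringBlockSite L 4 x i))
      (fun σ i => σ (ringBlockSite L 4 x i))) =
      akltProj (x + ((a : ℕ) : ZMod L)) (x + ((b : ℕ) : ZMod L)) := by
  have hg := ringBlockSite_bijective L 4 hL x
  have hs : ∀ c : Fin 4, ((ringBlockSite L 4 x c : ringBlock L 4 x) : ZMod L) = x + ((c : ℕ) : ZMod L) :=
    fun c => rfl
  simp only [akltProj, spinDot, spinBond, siteSpin, localOp_submatrix_sum,
    localOp_submatrix_smul, localOp_submatrix_add, localOp_submatrix_mul _ hg,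
    localOp_submatrix_onSite _ hg, localOp_submatrix_one _ hg, hs]

/-- **The local gap inequality on every four-site block of the ring** (`4 ≤ L`): with
`h_x = P₂(x,x+1) + P₂(x+1,x+2) + P₂(x+2,x+3)`, `h_x² - (5/12) h_x ≥ 0`, transported from the abstract
block (`akltOpenFour_sq_sub_smul_posSemidef`) by the positivity-preserving unital homomorphism
`localOp ∘ onRingBlock`. Knabe (1988) §2–3. [folklore] -/
theorem akltRing_block_sq_sub_smul_posSemidef (L : ℕ) [NeZero L] (hL : 4 ≤ L) (x : ZMod L) :
    ((akltProj x (x + 1) + akltProj (x + 1) (x + 1 + 1) + akltProj (x + 2) (x + 2 + 1)) *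
        (akltProj x (x + 1) + akltProj (x + 1) (x + 1 + 1) + akltProj (x + 2) (x + 2 + 1)) -
      ((5 / 12 : ℚ) : ℂ) •
        (akltProj x (x + 1) + akltProj (x + 1) (x + 1 + 1) + akltProj (x + 2) (x + 2 + 1))).PosSemidef := by
  have hg := ringBlockSite_bijective L 4 hL x
  set h4 : Op (Fin 4) 3 := akltProj (0 : Fin 4) 1 + akltProj 1 2 + akltProj 2 3 with hh4
  have hpsd : (localOp (ringBlock L 4 x)
      (onRingBlock L 4 x (h4 * h4 - ((5 / 12 : ℚ) : ℂ) • h4))).PosSemidef :=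
    posSemidef_localOp _ (posSemidef_onRingBlock L 4 x akltOpenFour_sq_sub_smul_posSemidef)
  have htr : localOp (ringBlock L 4 x) (onRingBlock L 4 x h4) =
      akltProj x (x + 1) + akltProj (x + 1) (x + 1 + 1) + akltProj (x + 2) (x + 2 + 1) := by
    have e1 : x + 1 + 1 = x + 2 := by ring
    have e2 : x + 2 + 1 = x + 3 := by ring
    have h0 : (((0 : Fin 4) : ℕ) : ZMod L) = 0 := by norm_num
    have h1 : (((1 : Fin 4) : ℕ) : ZMod L) = 1 := by norm_num
    have h2 : (((2 : Fin 4) : ℕ) : ZMod L) = 2 := by norm_num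
    have h3 : (((3 : Fin 4) : ℕ) : ZMod L) = 3 := by norm_num
    simp only [hh4, onRingBlock, localOp_submatrix_add, localOp_submatrix_ringBlock_akltProj L hL x,
      h0, h1, h2, h3, e1, e2, add_zero]
  have hm : localOp (ringBlock L 4 x) (onRingBlock L 4 x (h4 * h4 - ((5 / 12 : ℚ) : ℂ) • h4)) =
      localOp (ringBlock L 4 x) (onRingBlock L 4 x h4) * localOp (ringBlock L 4 x) (onRingBlock L 4 x h4) -
        ((5 / 12 : ℚ) : ℂ) • localOp (ringBlock L 4 x) (onRingBlock L 4 x h4) := by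
    simp only [onRingBlock, localOp_submatrix_sub, localOp_submatrix_smul, localOp_submatrix_mul _ hg]
  rw [hm, htr] at hpsd
  exact hpsd

/-- Bond projections of the ring at non-adjacent bonds commute: for `d ∉ {0, 1, -1}` the bonds
`{i, i+1}` and `{i+d, i+d+1}` are disjoint (`2 ≤ L`). [folklore] -/
theorem akltProj_ring_commute (L : ℕ) [NeZero L] (hL : 2 ≤ L) (i d : ZMod L) (hd0 : d ≠ 0)
    (hd1 : d ≠ 1) (hdm1 : d ≠ -1) :
    akltProj i (i + 1) * akltProj (i + d) (i + d + 1) = akltProj (i + d) (i + d + 1) * akltProj i (i + 1) := by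
  refine (akltProj_commute_of_disjoint (self_ne_add_one hL i) (self_ne_add_one hL (i + d)) ?_).eq
  rw [Finset.disjoint_insert_left, Finset.disjoint_singleton_left, Finset.mem_insert,
    Finset.mem_singleton, Finset.mem_insert, Finset.mem_singleton]
  refine ⟨?_, ?_⟩
  · rintro (h | h)
    · exact hd0 (by linear_combination -h)
    · exact hdm1 (by linear_combination -h)
  · rintro (h | h)
    · exact hd1 (by linear_combination -h)
    · exact hd0 (by linear_combination -h)

/-- **`(Σ_i P₂(i,i+1))² - ⅛ Σ_i P₂(i,i+1) ≥ 0` on every AKLT ring `ℤ/L`, `L ≥ 3`**: for `L ≥ 5`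
by Knabe's criterion with four-site blocks (`knabe_ring_sq_sub_smul_posSemidef`, local gap
`ε = 5/12 > 1/3`, so `(3ε - 1)/2 = 1/8`), and for `L = 3, 4` from the exact ring certificates
(gaps `5/6`, `1/3 ≥ 1/8`). Hence the spectrum of `Σ_i P₂(i,i+1)` lies in `{0} ∪ [1/8, ∞)`
uniformly in `L`. Knabe (1988) §2–3; AKLT, CMP 115 (1988), Thm. on the gap (§2). [cite: Knabe1988, §2–3] -/
theorem akltRing_sumProj_sq_sub_smul_posSemidef (L : ℕ) [NeZero L] (hL : 3 ≤ L) :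
    ((∑ i : ZMod L, akltProj i (i + 1)) * (∑ i : ZMod L, akltProj i (i + 1)) -
      ((1 / 8 : ℝ) : ℂ) • ∑ i : ZMod L, akltProj i (i + 1)).PosSemidef := by
  have hL2 : 2 ≤ L := by omega
  -- weakening `H² - γ H ≥ 0` to `H² - ⅛ H ≥ 0` for `γ ≥ ⅛`, using `H ≥ 0`
  have hH : (∑ i : ZMod L, akltProj i (i + 1)).PosSemidef :=
    posSemidef_sum _ fun i _ => posSemidef_akltProj (self_ne_add_one hL2 i)
  have weaken : ∀ γ : ℚ, (1 / 8 : ℚ) ≤ γ →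
      ((∑ i : ZMod L, akltProj i (i + 1)) * (∑ i : ZMod L, akltProj i (i + 1)) -
        ((γ : ℚ) : ℂ) • ∑ i : ZMod L, akltProj i (i + 1)).PosSemidef →
      ((∑ i : ZMod L, akltProj i (i + 1)) * (∑ i : ZMod L, akltProj i (i + 1)) -
        ((1 / 8 : ℝ) : ℂ) • ∑ i : ZMod L, akltProj i (i + 1)).PosSemidef := by
    intro γ hγ h
    have hid : (∑ i : ZMod L, akltProj i (i + 1)) * (∑ i : ZMod L, akltProj i (i + 1)) -
        ((1 / 8 : ℝ) : ℂ) • ∑ i : ZMod L, akltProj i (i + 1) =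
        ((∑ i : ZMod L, akltProj i (i + 1)) * (∑ i : ZMod L, akltProj i (i + 1)) -
          ((γ : ℚ) : ℂ) • ∑ i : ZMod L, akltProj i (i + 1)) +
          (((γ - 1 / 8 : ℚ) : ℝ) : ℂ) • ∑ i : ZMod L, akltProj i (i + 1) := by
      rw [← Complex.ofReal_ratCast]
      push_cast
      module
    rw [hid]
    refine h.add (hH.smul ?_)
    exact Complex.zero_le_real.2 (by exact_mod_cast sub_nonneg.2 hγ)
  rcases Nat.lt_or_ge L 5 with hlt | hge
  · -- `L = 3` or `L = 4`
    interval_cases L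
    · exact weaken (5 / 6) (by norm_num) akltRingThree_sq_sub_smul_posSemidef
    · exact weaken (1 / 3) (by norm_num) akltRingFour_sq_sub_smul_posSemidef
  · -- Knabe for `L ≥ 5`
    have h := knabe_ring_sq_sub_smul_posSemidef hge (fun i : ZMod L => akltProj i (i + 1))
      (fun i => akltProj_isHermitian i (i + 1))
      (fun i => akltProj_mul_self (self_ne_add_one hL2 i))
      (fun i d hd0 hd1 hdm1 => akltProj_ring_commute L hL2 i d hd0 hd1 hdm1) (5 / 12)
      (fun i => by
        have hb := akltRing_block_sq_sub_smul_posSemidef L (by omega) i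
        have hc : (((5 / 12 : ℚ) : ℂ)) = ((5 / 12 : ℝ) : ℂ) := by push_cast; ring
        rwa [hc] at hb)
    have hc : (((3 * (5 / 12 : ℝ) - 1) / 2 : ℝ) : ℂ) = ((1 / 8 : ℝ) : ℂ) := by push_cast; ring
    rwa [hc] at h

/-- **The AKLT gap, conditional on uniqueness of the periodic ground state.** If the AKLT ring has a
unique ground state for every `L ≥ 3` (`aklt_unique_periodic`), then it has the uniform spectral gap
`γ = 1/4`: `E₁(L) - E₀(L) ≥ 1/4` for all `L ≥ 3`. Indeed `H_L - E₀ = 2 Σ_i P₂(i,i+1)`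
(`akltRing_eq`, `E₀ = -2L/3` by `akltRing_groundEnergy`), so
`(H_L - E₀)² - ¼ (H_L - E₀) = 4 [(ΣP₂)² - ⅛ ΣP₂] ≥ 0` (`akltRing_sumProj_sq_sub_smul_posSemidef`),
and `hasSpectralGap_of_sq_sub_smul_posSemidef` applies. AKLT, CMP 115 (1988), §2 (existence of the
gap); Knabe (1988) (the finite-size method); Tasaki (2020) Thm. 7.5. [cite: Knabe1988, §2–3] -/
theorem aklt_gap_of_aklt_unique_periodic (huniq : aklt_unique_periodic) : aklt_gap := by
  refine ⟨1 / 4, by norm_num, fun L _ hL => ?_⟩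
  have hL2 : 2 ≤ L := by omega
  have hE : (akltRing L).groundEnergy = -(2 * (L : ℝ) / 3) := akltRing_groundEnergy L hL2
  have hshift : akltRing L - algebraMap ℝ (Op (ZMod L) 3) (akltRing L).groundEnergy =
      (2 : ℂ) • ∑ i : ZMod L, akltProj i (i + 1) := by
    rw [hE, akltRing_eq, Algebra.algebraMap_eq_smul_one, ← Complex.coe_smul]
    push_cast
    module
  refine hasSpectralGap_of_sq_sub_smul_posSemidef (akltRing_isHermitian L) (huniq L hL)
    (by norm_num) ?_
  rw [hshift]
  have hid : ((2 : ℂ) • ∑ i : ZMod L, akltProj i (i + 1)) * ((2 : ℂ) • ∑ i : ZMod L, akltProj i (i + 1)) -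
      ((1 / 4 : ℝ) : ℂ) • ((2 : ℂ) • ∑ i : ZMod L, akltProj i (i + 1)) =
      (4 : ℂ) • ((∑ i : ZMod L, akltProj i (i + 1)) * (∑ i : ZMod L, akltProj i (i + 1)) -
        ((1 / 8 : ℝ) : ℂ) • ∑ i : ZMod L, akltProj i (i + 1)) := by
    rw [smul_mul_smul_comm]
    push_cast
    module
  rw [hid]
  exact (akltRing_sumProj_sq_sub_smul_posSemidef L hL).smul (by norm_num)


/-- **Discharge of `aklt_gap` (hubbard.S15: the AKLT ring has a uniform spectral gap).** There is
`γ > 0` (here `γ = 1/4`) such that for every `L ≥ 3` the AKLT ring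
`H_L = Σ_{i ∈ ℤ/L} (𝐒_i·𝐒_{i+1} + ⅓(𝐒_i·𝐒_{i+1})²)` has a unique ground state and all other
eigenvalues are `≥ E₀(L) + γ` (`Matrix.HasSpectralGap`): uniqueness is
`aklt_unique_periodic_holds` (Fannes–Nachtergaele–Werner Lemma 5.5 / Example 7), and the gap
inequality `(H_L - E₀)² ≥ ¼ (H_L - E₀)` is Knabe's finite-size criterion with four-site blocks fed
by exact certificates (`aklt_gap_of_aklt_unique_periodic`). Affleck–Kennedy–Lieb–Tasaki, CMP 115
(1988), §2 (the gap of the periodic chain); Knabe, J. Stat. Phys. 52 (1988), §2–3; Tasaki (2020),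
Thm. 7.5 (the locator carried by the fact); Fannes–Nachtergaele–Werner (1992), Thm. 6.4.
[cite: Knabe1988, §2–3] -/
theorem aklt_gap_holds : aklt_gap :=
  aklt_gap_of_aklt_unique_periodic aklt_unique_periodic_holds

end Assembly

end Literature.MathematicalPhysics.QuantumLattice
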